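import Mathlib
import Summits.ResolutionOfSingularities.ResolutionOfSingularities.Theorems.WildQuotientsWildQuotientResolutionJordanFourThirdTransport
import Summits.ResolutionOfSingularities.ResolutionOfSingularities.Theorems.WildQuotientsWildQuotientResolutionJordanFourHalfTransport
import Summits.ResolutionOfSingularities.ResolutionOfSingularities.Theorems.WildQuotientsWildQuotientResolutionJordanFourTwistedChartFixed

/-!
# V4U pieces 0 and T — the named cone presentations `φ₀`, `φ_T` (quotient presentation `≃ₐ` invariant subalgebra)

(crux stmt-ResolutionOfSingularities-15640 `WildQuotients.WildQuotientResolution`, line `Sketch`,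
sector `|G| = p`; programme V4U of `L/w45c/CHAIN.md` v7.5a, res-L1-w45c-plan-1 GO 2026-08-27T06:27:22Z
«compose φ₀ AND φ_T as named def + value lemmas» for the ring bricks H₀ (res-type-087) / H₁
(res-type-036) of lead-1's `BlowupExit.exists_isBlowup_regular_of_vertexPresentation` (p505172);
`L/w45c/V4U-DESIGN.md` §5. [OURS · L1 W4.5c] — NOT a statement of any manuscript; replaces the role
of no printed item. Prover res-L1-w45c-stub-1.)

PIECE 0 (`μ₃`, chart `D₊(x_a² t)`, root-chart action `σ_U` ABSTRACT by its law):
* `invSubalgebra0 k n σU a b c` — the `σ_U`-invariants of the chart-`0` subring of record (stub-2 p490009),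
  `coe_invSubalgebra0 : ↑S₀ = {f | f ∈ adjoin k (chart0 gens) ∧ σU f = f}` (the set of p505037);
* `invSubalgebra0_eq_map_of_mod_three_eq_one/_two` — `S₀ = (Third112.presentation k n a b c).range.map θ₀`
  (`p ≡ 1`), `= (Third112.presentation k n b c a).range.map θ₀` (`p ≡ 2`), `θ₀ = subst0 k n a b c d p`;
* **`phiZero₁` / `phiZero₂ : (k[Y_{Fin n ⊕ Fin 4}] ⧸ ker (Third112.presentation …)) ≃ₐ[k] ↥S₀`**
  (`Ideal.quotientKerEquivRange ≫ thirdTransportEquiv ≫ equivOfEq`), values `coe_phiZero₁_mk` /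
  `coe_phiZero₂_mk : ↑(φ₀ (mk P)) = θ₀ (presentation P)`.
PIECE T (`μ₂`, twisted chart, translation `τ = Σ_T` ABSTRACT by its law, `p` an odd prime):
* `invSubalgebraT k n a b c τ`, `coe_invSubalgebraT : ↑S_T = {f | f ∈ adjoin k (evenGens k n a b c) ∧ τ f = f}`;
* `invSubalgebraT_eq_map : S_T = (Half111.presentation k n b a c).range.map (substN k n b c p)`
  (p501651 + res-type-087's `map_substN_adjoin_evenGens` / `range_halfPresentation_eq_adjoin_evenGens`, p503660);
* **`phiT : (k[Y_{Fin n ⊕ Fin 3}] ⧸ ker (Half111.presentation k n b a c)) ≃ₐ[k] ↥S_T`**, `coe_phiT_mk`.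
HP₀ case-splits on `p % 3` (the cone-side inputs `Third112.blowup_regular` etc. are triple-generic).
-/

-- single-problem summit: the doubled namespace component `ResolutionOfSingularities` is forced
set_option linter.dupNamespace false

noncomputable section

open MvPolynomial

namespace Summit.ResolutionOfSingularities.ResolutionOfSingularities.Theorems.WildQuotientResolution.JordanFour

section PieceZero

variable (k : Type) [Field k] (n : ℕ)
  (σU : MvPolynomial (Fin n) k ≃ₐ[k] MvPolynomial (Fin n) k) (a b c d : Fin n)

/-- **`S₀`**: the `σ_U`-invariant subalgebra of the chart-`0` subring of record (generators of
`JordanFour.chart0_ringEquiv_adjoin`, p490009). [OURS · L1 W4.5c] -/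
noncomputable def invSubalgebra0 : Subalgebra k (MvPolynomial (Fin n) k) :=
  Algebra.adjoin k
      (Set.range (fun s : Fin n => MvPolynomial.aeval
          (fun s : Fin n => (if s = a then X a ^ 3 else
            X s * X a ^ (if s = b then 2 else if s = c then 1 else 0) : MvPolynomial (Fin n) k))
          (X s : MvPolynomial (Fin n) k)) ∪
        Set.range (![1, X a * X b ^ 2, X b * X c, X c ^ 3, X b ^ 3, X b ^ 2 * X c ^ 2,
            X b * X c ^ 4, X c ^ 6] : Fin 8 → MvPolynomial (Fin n) k)) ⊓
    AlgHom.equalizer (σU : MvPolynomial (Fin n) k →ₐ[k] MvPolynomial (Fin n) k)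
      (AlgHom.id k (MvPolynomial (Fin n) k))

/-- Membership in `S₀`. [folklore] -/
theorem mem_invSubalgebra0_iff (f : MvPolynomial (Fin n) k) :
    f ∈ invSubalgebra0 k n σU a b c ↔
      f ∈ Algebra.adjoin k
        (Set.range (fun s : Fin n => MvPolynomial.aeval
            (fun s : Fin n => (if s = a then X a ^ 3 else
              X s * X a ^ (if s = b then 2 else if s = c then 1 else 0) : MvPolynomial (Fin n) k))
            (X s : MvPolynomial (Fin n) k)) ∪
          Set.range (![1, X a * X b ^ 2, X b * X c, X c ^ 3, X b ^ 3, X b ^ 2 * X c ^ 2,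
              X b * X c ^ 4, X c ^ 6] : Fin 8 → MvPolynomial (Fin n) k)) ∧ σU f = f := by
  rw [invSubalgebra0, Algebra.mem_inf, AlgHom.mem_equalizer]
  rfl

/-- `↑S₀` is literally the set of `JordanFour.chart0_fixedPoints_eq_*` (p505037). [folklore] -/
theorem coe_invSubalgebra0 :
    (invSubalgebra0 k n σU a b c : Set (MvPolynomial (Fin n) k)) =
      {f : MvPolynomial (Fin n) k | f ∈ Algebra.adjoin k
        (Set.range (fun s : Fin n => MvPolynomial.aeval
            (fun s : Fin n => (if s = a then X a ^ 3 else
              X s * X a ^ (if s = b then 2 else if s = c then 1 else 0) : MvPolynomial (Fin n) k))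
            (X s : MvPolynomial (Fin n) k)) ∪
          Set.range (![1, X a * X b ^ 2, X b * X c, X c ^ 3, X b ^ 3, X b ^ 2 * X c ^ 2,
              X b * X c ^ 4, X c ^ 6] : Fin 8 → MvPolynomial (Fin n) k)) ∧ σU f = f} := by
  ext f
  exact mem_invSubalgebra0_iff k n σU a b c f

variable (hab : a ≠ b) (hac : a ≠ c) (had : a ≠ d) (hbc : b ≠ c) (hbd : b ≠ d) (hcd : c ≠ d)
  (hb : σU (X b) = X b + X a) (hc : σU (X c) = X c + X a * X b)
  (hd : σU (X d) = X d + X a * X c)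
  (hσ : ∀ i, i ≠ b → i ≠ c → i ≠ d → σU (X i) = X i)

include hab hac had hbc hbd hcd hb hc hd hσ in
/-- `S₀ = (Third112.presentation k n a b c).range.map θ₀` for `p ≡ 1 (mod 3)`. [OURS · L1 W4.5c] -/
theorem invSubalgebra0_eq_map_of_mod_three_eq_one (p : ℕ) (hp : p.Prime) (hp5 : 5 ≤ p) [CharP k p]
    (hp3 : p % 3 = 1) :
    invSubalgebra0 k n σU a b c = (Third112.presentation k n a b c).range.map (subst0 k n a b c d p) :=
  SetLike.coe_injective (by
    rw [coe_invSubalgebra0]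
    exact chart0_fixedPoints_eq_map_subst0_of_mod_three_eq_one k n σU a b c d hab hac had hbc hbd hcd
      hb hc hd hσ p hp hp5 hp3)

include hab hac had hbc hbd hcd hb hc hd hσ in
/-- `S₀ = (Third112.presentation k n b c a).range.map θ₀` for `p ≡ 2 (mod 3)`. [OURS · L1 W4.5c] -/
theorem invSubalgebra0_eq_map_of_mod_three_eq_two (p : ℕ) (hp : p.Prime) (hp5 : 5 ≤ p) [CharP k p]
    (hp3 : p % 3 = 2) :
    invSubalgebra0 k n σU a b c = (Third112.presentation k n b c a).range.map (subst0 k n a b c d p) :=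
  SetLike.coe_injective (by
    rw [coe_invSubalgebra0]
    exact chart0_fixedPoints_eq_map_subst0_of_mod_three_eq_two k n σU a b c d hab hac had hbc hbd hcd
      hb hc hd hσ p hp hp5 hp3)

include hab hac had hbc hbd hcd hb hc hd hσ in
/-- **`φ₀` for `p ≡ 1 (mod 3)`**: the presented `⅓(1,1,2)`-ring (triple `(a,b,c)` ↔ `(ρ, N, c′)`) is
isomorphic to the invariant subalgebra `S₀`. [OURS · L1 W4.5c] -/
noncomputable def phiZero₁ (p : ℕ) (hp : p.Prime) (hp5 : 5 ≤ p) [CharP k p] (hp3 : p % 3 = 1) :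
    (MvPolynomial (Fin n ⊕ Fin 4) k ⧸ RingHom.ker (Third112.presentation k n a b c)) ≃ₐ[k]
      ↥(invSubalgebra0 k n σU a b c) :=
  (Ideal.quotientKerEquivRange (Third112.presentation k n a b c)).trans
    ((thirdTransportEquiv k n a b c d p hab hbc hbd hcd hp hp5 _).trans
      (Subalgebra.equivOfEq _ _ (invSubalgebra0_eq_map_of_mod_three_eq_one k n σU a b c d hab hac had
        hbc hbd hcd hb hc hd hσ p hp hp5 hp3).symm))

include hab hac had hbc hbd hcd hb hc hd hσ in
/-- **Values of `φ₀` (`p ≡ 1`)**: `φ₀ (mk P) = θ₀ (presentation P)` — on generators: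
`Y_{inl a} ↦ ρ³`, `Y_{inl b} ↦ N³`, `Y_{inl c} ↦ c′³`, `Y_{inr 0} ↦ ρ²N`, `Y_{inr 1} ↦ ρN²`, `Y_{inr 2} ↦ ρc′`,
`Y_{inr 3} ↦ Nc′`, `Y_{inl d} ↦ d′`, passengers `↦ X i` (`Third112.presentation_*`, `subst0_X_*`).
[OURS · L1 W4.5c] -/
theorem coe_phiZero₁_mk (p : ℕ) (hp : p.Prime) (hp5 : 5 ≤ p) [CharP k p] (hp3 : p % 3 = 1)
    (P : MvPolynomial (Fin n ⊕ Fin 4) k) :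
    ((phiZero₁ k n σU a b c d hab hac had hbc hbd hcd hb hc hd hσ p hp hp5 hp3
        (Ideal.Quotient.mk _ P) : invSubalgebra0 k n σU a b c) : MvPolynomial (Fin n) k) =
      subst0 k n a b c d p (Third112.presentation k n a b c P) :=
  rfl

include hab hac had hbc hbd hcd hb hc hd hσ in
/-- **`φ₀` for `p ≡ 2 (mod 3)`**: the presented `⅓(1,1,2)`-ring on the PERMUTED triple `(b,c,a)` ↔
`(N, c′, ρ)` is isomorphic to `S₀`. [OURS · L1 W4.5c] -/
noncomputable def phiZero₂ (p : ℕ) (hp : p.Prime) (hp5 : 5 ≤ p) [CharP k p] (hp3 : p % 3 = 2) :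
    (MvPolynomial (Fin n ⊕ Fin 4) k ⧸ RingHom.ker (Third112.presentation k n b c a)) ≃ₐ[k]
      ↥(invSubalgebra0 k n σU a b c) :=
  (Ideal.quotientKerEquivRange (Third112.presentation k n b c a)).trans
    ((thirdTransportEquiv k n a b c d p hab hbc hbd hcd hp hp5 _).trans
      (Subalgebra.equivOfEq _ _ (invSubalgebra0_eq_map_of_mod_three_eq_two k n σU a b c d hab hac had
        hbc hbd hcd hb hc hd hσ p hp hp5 hp3).symm))

include hab hac had hbc hbd hcd hb hc hd hσ in
/-- **Values of `φ₀` (`p ≡ 2`)**: `φ₀ (mk P) = θ₀ (presentation_{(b,c,a)} P)` — on generators: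
`Y_{inl b} ↦ N³`, `Y_{inl c} ↦ c′³`, `Y_{inl a} ↦ ρ³`, `Y_{inr 0} ↦ N²c′`, `Y_{inr 1} ↦ Nc′²`,
`Y_{inr 2} ↦ Nρ`, `Y_{inr 3} ↦ c′ρ`. [OURS · L1 W4.5c] -/
theorem coe_phiZero₂_mk (p : ℕ) (hp : p.Prime) (hp5 : 5 ≤ p) [CharP k p] (hp3 : p % 3 = 2)
    (P : MvPolynomial (Fin n ⊕ Fin 4) k) :
    ((phiZero₂ k n σU a b c d hab hac had hbc hbd hcd hb hc hd hσ p hp hp5 hp3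
        (Ideal.Quotient.mk _ P) : invSubalgebra0 k n σU a b c) : MvPolynomial (Fin n) k) =
      subst0 k n a b c d p (Third112.presentation k n b c a P) :=
  rfl

end PieceZero

section PieceT

variable (k : Type) [Field k] (n : ℕ) (a b c : Fin n)
  (τ : MvPolynomial (Fin n) k →ₐ[k] MvPolynomial (Fin n) k)

/-- **`S_T`**: the `Σ_T`-invariants of the even subalgebra `E = adjoin k (evenGens k n a b c)` of the
twisted chart. [OURS · L1 W4.5c] -/
noncomputable def invSubalgebraT : Subalgebra k (MvPolynomial (Fin n) k) :=
  Algebra.adjoin k (evenGens k n a b c) ⊓ AlgHom.equalizer τ (AlgHom.id k (MvPolynomial (Fin n) k))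

/-- Membership in `S_T`. [folklore] -/
theorem mem_invSubalgebraT_iff (f : MvPolynomial (Fin n) k) :
    f ∈ invSubalgebraT k n a b c τ ↔ f ∈ Algebra.adjoin k (evenGens k n a b c) ∧ τ f = f := by
  rw [invSubalgebraT, Algebra.mem_inf, AlgHom.mem_equalizer]
  rfl

/-- `↑S_T` is literally the set of `JordanFour.translate_fixedPoints_inter_even_eq` (p501651). [folklore] -/
theorem coe_invSubalgebraT :
    (invSubalgebraT k n a b c τ : Set (MvPolynomial (Fin n) k)) =
      {f : MvPolynomial (Fin n) k | f ∈ Algebra.adjoin k (evenGens k n a b c) ∧ τ f = f} := by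
  ext f
  exact mem_invSubalgebraT_iff k n a b c τ f

variable (hab : a ≠ b) (hac : a ≠ c) (hbc : b ≠ c)
  (hτc : τ (X c) = X c + X b) (hτ : ∀ i, i ≠ c → τ (X i) = X i)

include hab hac hbc in
/-- The even subalgebra is symmetric in the two odd slots `a, b`. [folklore] -/
theorem adjoin_evenGens_swap :
    Algebra.adjoin k (evenGens k n b a c) = Algebra.adjoin k (evenGens k n a b c) := by
  classical
  let w : Fin n → ZMod 2 := fun i => if i = a ∨ i = b ∨ i = c then 1 else 0
  have hwa : w a = 1 := if_pos (Or.inl rfl)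
  have hwb : w b = 1 := if_pos (Or.inr (Or.inl rfl))
  have hwc : w c = 1 := if_pos (Or.inr (Or.inr rfl))
  have hw0 : ∀ i, i ≠ a → i ≠ b → i ≠ c → w i = 0 :=
    fun i hia hib hic => if_neg (not_or.mpr ⟨hia, not_or.mpr ⟨hib, hic⟩⟩)
  have hw0' : ∀ i, i ≠ b → i ≠ a → i ≠ c → w i = 0 := fun i hib hia hic => hw0 i hia hib hic
  ext f
  rw [mem_adjoin_evenGens_iff k n b a c (Ne.symm hab) hbc hac w hwb hwa hwc hw0',
    mem_adjoin_evenGens_iff k n a b c hab hac hbc w hwa hwb hwc hw0]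

include hab hac hbc hτc hτ in
/-- `S_T = (Half111.presentation k n b a c).range.map S_N` (`p` an odd prime); triple `(b, a, c)` ↔
`(s, A, N)` = the generator order of record `s², sA, sN, A², AN, N²`. [OURS · L1 W4.5c] -/
theorem invSubalgebraT_eq_map (p : ℕ) (hp : p.Prime) (hp2 : p ≠ 2) [CharP k p] :
    invSubalgebraT k n a b c τ = (Half111.presentation k n b a c).range.map (substN k n b c p) := by
  rw [range_halfPresentation_eq_adjoin_evenGens k n b a c, adjoin_evenGens_swap k n a b c hab hac hbc,
    map_substN_adjoin_evenGens k n a b c p hab hac hbc]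
  refine SetLike.coe_injective ?_
  rw [coe_invSubalgebraT]
  exact translate_fixedPoints_inter_even_eq k n a b c hab hac hbc τ hτc hτ p hp hp2

include hab hac hbc hτc hτ in
/-- **`φ_T`**: the presented `½(1,1,1)`-ring (triple `(b,a,c)` ↔ `(s, A, N)`) is isomorphic to the
invariant subalgebra `S_T` (`p` an odd prime). [OURS · L1 W4.5c] -/
noncomputable def phiT (p : ℕ) (hp : p.Prime) (hp2 : p ≠ 2) [CharP k p] :
    (MvPolynomial (Fin n ⊕ Fin 3) k ⧸ RingHom.ker (Half111.presentation k n b a c)) ≃ₐ[k]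
      ↥(invSubalgebraT k n a b c τ) :=
  (Ideal.quotientKerEquivRange (Half111.presentation k n b a c)).trans
    ((((Half111.presentation k n b a c).range).equivMapOfInjective _
        (substN_injective k n b c p hbc hp.two_le)).trans
      (Subalgebra.equivOfEq _ _ (invSubalgebraT_eq_map k n a b c τ hab hac hbc hτc hτ p hp hp2).symm))

include hab hac hbc hτc hτ in
/-- **Values of `φ_T`**: `φ_T (mk P) = S_N (presentation P)` — on generators: `Y_{inl b} ↦ s²`,
`Y_{inl a} ↦ A²`, `Y_{inl c} ↦ N²`, `Y_{inr 0} ↦ sA`, `Y_{inr 1} ↦ sN`, `Y_{inr 2} ↦ AN`, `Y_{inl d}`/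
passengers `↦ X i` (`Half111.presentation_*`, `substN_X_*`). [OURS · L1 W4.5c] -/
theorem coe_phiT_mk (p : ℕ) (hp : p.Prime) (hp2 : p ≠ 2) [CharP k p]
    (P : MvPolynomial (Fin n ⊕ Fin 3) k) :
    ((phiT k n a b c τ hab hac hbc hτc hτ p hp hp2 (Ideal.Quotient.mk _ P) : invSubalgebraT k n a b c τ) :
        MvPolynomial (Fin n) k) = substN k n b c p (Half111.presentation k n b a c P) :=
  rfl

end PieceT

end Summit.ResolutionOfSingularities.ResolutionOfSingularities.Theorems.WildQuotientResolution.JordanFour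

end
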